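import Summits.AtomisticToContinuum.HydrodynamicLimit.Theorems.CollisionIsometryCLTAdaptedWeightCLTBHContactToMassHellinger
import Summits.AtomisticToContinuum.HydrodynamicLimit.Theorems.CollisionIsometryCLTAdaptedWeightCLTTLPastDampingKernel

/-!
# Stub `stub_contactToMass` (S4) of the line `block-h-dissipation-closure`, helper file 4: mass bookkeeping of
the cell weights and the a-priori range of `massDiss`
(crux `CollisionIsometryCLT.AdaptedWeightCLT`, stmt-AtomisticToContinuum-14868; `--supports`, anchor
`bhContactToMass_mass_anchor`)

Dynamics-free bookkeeping on `𝕋³` for an admissible cell family `ψ` (unit mass, continuity):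
* `integral_cw`: `∫ₓ ψ_N(x_i − x) dx = 1` (translation/negation invariance of Haar on `𝕋³`,
  `PastDamping.integral_comp_sub_left`), hence `∫ₓ W_x dx = N + 1`, `∫ₓ ρ̄_x dx = 1` (`ρ̄ = W/(N+1)`), and for
  every set `S` of particles `∫ₓ (N+1)⁻¹ Σ_{i ∈ S} ψ_N(x_i − x) dx = #S/(N+1)` (`integral_sum_cw_div`) — the
  identity that turns the MASS-WEIGHTED idle fraction of the cells, integrated over `x`, into the plain idle
  fraction that H1 controls;
* `integral_massDensity_le_one`: `∫ₓ ρ̄_x 𝒟h(f̂_x) dx ≤ 1` (`𝒟h ≤ 1`, `integral_mono_of_nonneg`: no integrability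
  of the left integrand is needed), hence the a-priori range `0 ≤ massDiss ≤ t` (`massDiss_le`,
  `massDiss_mem_Icc`): `massDiss` is a bounded functional, so `P{η < massDiss} ≤ E[massDiss]/η` is available to
  the charging argument.
No definitions.
-/

namespace Summit.AtomisticToContinuum.HydrodynamicLimit.Theorems.BlockHDissipation

open scoped BigOperators Topology Classical MeasureTheory ENNReal InnerProductSpace
open Filter Set MeasureTheory
open Literature.Analysis.FluidPDE
open Summit.AtomisticToContinuum.HydrodynamicLimit.Theorems.ContactSourceDuhamel (T3 V3 Cfg Vel Flow Flows)
open Summit.AtomisticToContinuum.HydrodynamicLimit.Theorems.ContactSourceDuhamel.TimeLocal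
open Literature.MathematicalPhysics.KineticTheory (hsDiameter localGibbsLaw collide hardSphereKernel sphereMeasure)

noncomputable section

namespace ContactToMass

variable {N : ℕ} {γc C' : ℝ} {ψ : ℕ → T3 → ℝ}

/-! ## Unit mass of the cell weights -/

/-- The cell weight of a particle is continuous in the location `x` (smooth kernel). -/
theorem continuous_cw_loc (hadm : AdmissibleKernel γc C' ψ) (w : Cfg N) (i : Fin (N + 1)) :
    Continuous fun x : T3 => cw N ψ w x i := by
  unfold cw
  exact (hadm.1 N).continuous.comp (continuous_const.sub continuous_id)

/-- The cell weight of a particle is integrable in the location. -/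
theorem integrable_cw_loc (hadm : AdmissibleKernel γc C' ψ) (w : Cfg N) (i : Fin (N + 1)) :
    Integrable fun x : T3 => cw N ψ w x i :=
  PastDamping.integrable_of_continuous_T3 (continuous_cw_loc hadm w i)

/-- **Unit mass**: `∫ₓ ψ_N(x_i − x) dx = 1`. -/
theorem integral_cw (hadm : AdmissibleKernel γc C' ψ) (w : Cfg N) (i : Fin (N + 1)) :
    ∫ x, cw N ψ w x i = 1 := by
  unfold cw
  rw [PastDamping.integral_comp_sub_left (ψ N)]
  exact hadm.2.2.1 N

/-- `∫ₓ (N+1)⁻¹ Σ_{i ∈ S} ψ_N(x_i − x) dx = #S / (N+1)` for every set `S` of particles. -/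
theorem integral_sum_cw_div (hadm : AdmissibleKernel γc C' ψ) (w : Cfg N) (S : Finset (Fin (N + 1))) :
    ∫ x, ((N + 1 : ℕ) : ℝ)⁻¹ * ∑ i ∈ S, cw N ψ w x i = (S.card : ℝ) / ((N + 1 : ℕ) : ℝ) := by
  rw [integral_const_mul, integral_finsetSum _ fun i _ => integrable_cw_loc hadm w i]
  simp only [integral_cw hadm w, Finset.sum_const, nsmul_eq_mul, mul_one]
  rw [div_eq_inv_mul]

/-- The total cell weight is continuous in the location. -/
theorem continuous_cW_loc (hadm : AdmissibleKernel γc C' ψ) (w : Cfg N) : Continuous fun x : T3 => cW N ψ w x := by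
  unfold cW
  exact continuous_finsetSum _ fun i _ => continuous_cw_loc hadm w i

/-- The total cell weight is integrable in the location. -/
theorem integrable_cW_loc (hadm : AdmissibleKernel γc C' ψ) (w : Cfg N) : Integrable fun x : T3 => cW N ψ w x :=
  PastDamping.integrable_of_continuous_T3 (continuous_cW_loc hadm w)

/-- `∫ₓ W_x dx = N + 1`. -/
theorem integral_cW (hadm : AdmissibleKernel γc C' ψ) (w : Cfg N) : ∫ x, cW N ψ w x = ((N + 1 : ℕ) : ℝ) := by
  have h := integral_sum_cw_div hadm w Finset.univ
  rw [integral_const_mul, Finset.card_univ, Fintype.card_fin] at h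
  have hN : ((N + 1 : ℕ) : ℝ) ≠ 0 := by positivity
  have h2 : ((N + 1 : ℕ) : ℝ)⁻¹ * ∫ x, cW N ψ w x = 1 := by
    rw [div_self hN] at h
    exact h
  field_simp at h2
  linarith [h2]

/-- **`∫ₓ ρ̄_x dx = 1`** (`ρ̄ = W/(N+1)`). -/
theorem integral_rho (hadm : AdmissibleKernel γc C' ψ) (w : Cfg N) :
    ∫ x, ((N + 1 : ℕ) : ℝ)⁻¹ * cW N ψ w x = 1 := by
  rw [integral_const_mul, integral_cW hadm w]
  have hN : ((N + 1 : ℕ) : ℝ) ≠ 0 := by positivity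
  exact inv_mul_cancel₀ hN

/-! ## The a-priori range of `massDiss` -/

/-- **`∫ₓ ρ̄_x 𝒟h(f̂_x) dx ≤ 1`** for an admissible (nonnegative, unit-mass) cell family and `δ ∈ [0, 1]`. -/
theorem integral_massDensity_le_one (hadm : AdmissibleKernel γc C' ψ) {δ : ℝ} (hδ0 : 0 ≤ δ) (hδ1 : δ ≤ 1)
    (h : ℝ) (w : Cfg N) :
    ∫ x, ((N + 1 : ℕ) : ℝ)⁻¹ * cW N ψ w x * hellDiss (cellLaw N ψ h δ w x) ≤ 1 := by
  calc ∫ x, ((N + 1 : ℕ) : ℝ)⁻¹ * cW N ψ w x * hellDiss (cellLaw N ψ h δ w x)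
      ≤ ∫ x, ((N + 1 : ℕ) : ℝ)⁻¹ * cW N ψ w x :=
        integral_mono_of_nonneg (Eventually.of_forall fun x => cW_mul_hellDiss_nonneg hadm.2.1 hδ0 hδ1 h w x)
          ((integrable_cW_loc hadm w).const_mul _)
          (Eventually.of_forall fun x => cW_mul_hellDiss_le hadm.2.1 hδ0 hδ1 h w x)
    _ = 1 := integral_rho hadm w

/-- The space integral of the mass-weighted dissipation is nonnegative. -/
theorem integral_massDensity_nonneg (hψ : ∀ N y, 0 ≤ ψ N y) {δ : ℝ} (hδ0 : 0 ≤ δ) (hδ1 : δ ≤ 1) (h : ℝ)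
    (w : Cfg N) : 0 ≤ ∫ x, ((N + 1 : ℕ) : ℝ)⁻¹ * cW N ψ w x * hellDiss (cellLaw N ψ h δ w x) :=
  integral_nonneg fun x => cW_mul_hellDiss_nonneg hψ hδ0 hδ1 h w x

/-- **`massDiss ≤ t`** on the horizon `[0, t]` (`t ≥ 0`). -/
theorem massDiss_le (hadm : AdmissibleKernel γc C' ψ) {σ : ℝ} (Φ : Flow σ N) {h δ : ℝ} (hδ0 : 0 ≤ δ) (hδ1 : δ ≤ 1)
    {t : ℝ} (ht : 0 ≤ t) (z : Cfg N) : massDiss σ N Φ ψ h δ t z ≤ t := by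
  unfold massDiss
  have h1 : ∫ s in Icc 0 t, (1 : ℝ) = t := by
    rw [setIntegral_const, smul_eq_mul, mul_one, Measure.real, Real.volume_Icc, sub_zero, ENNReal.toReal_ofReal ht]
  calc ∫ s in Icc 0 t, ∫ x, ((N + 1 : ℕ) : ℝ)⁻¹ * cW N ψ (Φ.flow s z) x * hellDiss (cellLaw N ψ h δ (Φ.flow s z) x)
      ≤ ∫ s in Icc 0 t, (1 : ℝ) :=
        integral_mono_of_nonneg (Eventually.of_forall fun s => integral_massDensity_nonneg hadm.2.1 hδ0 hδ1 h _)
          (integrableOn_const (by rw [Real.volume_Icc]; exact ENNReal.ofReal_ne_top))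
          (Eventually.of_forall fun s => integral_massDensity_le_one hadm hδ0 hδ1 h _)
    _ = t := h1

/-- `massDiss ∈ [0, t]`. -/
theorem massDiss_mem_Icc (hadm : AdmissibleKernel γc C' ψ) {σ : ℝ} (Φ : Flow σ N) {h δ : ℝ} (hδ0 : 0 ≤ δ)
    (hδ1 : δ ≤ 1) {t : ℝ} (ht : 0 ≤ t) (z : Cfg N) : massDiss σ N Φ ψ h δ t z ∈ Icc 0 t :=
  ⟨massDiss_nonneg hadm.2.1 Φ hδ0 hδ1 t z, massDiss_le hadm Φ hδ0 hδ1 ht z⟩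

end ContactToMass

/-- Registration anchor of this helper file (`--supports stmt-AtomisticToContinuum-14868`, stub
`stub_contactToMass`, file 4): for an admissible cell family and `δ ∈ [0, 1]` the mass-weighted dissipation of the
horizon `[0, t]`, `t ≥ 0`, lies in `[0, t]` — the `∀`-closed form of `ContactToMass.massDiss_mem_Icc`. -/
theorem bhContactToMass_mass_anchor : ∀ (N : ℕ) (γc C' : ℝ) (ψ : ℕ → T3 → ℝ), AdmissibleKernel γc C' ψ →
    ∀ (σ : ℝ) (Φ : Flow σ N) (h δ : ℝ), 0 ≤ δ → δ ≤ 1 → ∀ t : ℝ, 0 ≤ t → ∀ z : Cfg N,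
      massDiss σ N Φ ψ h δ t z ∈ Icc 0 t :=
  fun _ _ _ _ hadm _ Φ _ _ hδ0 hδ1 _ ht z => ContactToMass.massDiss_mem_Icc hadm Φ hδ0 hδ1 ht z

end

end Summit.AtomisticToContinuum.HydrodynamicLimit.Theorems.BlockHDissipation
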